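import Literature.AlgebraicGeometry.Frobenioids.ArchimedeanFSMLifting
import Literature.AlgebraicGeometry.Frobenioids.ArchimedeanFSMFFComplexRegime
import HarnessLib

/-!
# Frobenioids II, Proposition 3.4 (vi) "in particular" (irreducible) and (viii): per-tower HEAD forms
# (abc-iut cell, D-0079 L-F [FrdI/II] sub-cell, pack A; seat abc-iut-w5-d246; LF-FRD rows F-0824
# `ArchFrd.Tower.PropVI_irreducible`, F-0822 `ArchFrd.Tower.PropVIII`)

Mochizuki, *The geometry of Frobenioids II: poly-Frobenioids*, Kyushu J. Math. **62** (2008)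
401–460, §3, Proposition 3.4 (vi), (viii), kurims p. 30 (proof pp. 31–33)
[cite: MochizukiFrdII2008, Prop 3.4 (vi)(viii) p.30].

PROOF-ONLY bridging file (nothing is defined, no statement retyped or strengthened, no new mathematics):
the two rows are PARAMETRISED schemata — predicates of an abstract tower `T : ArchFrd.Tower π`
(`ArchimedeanFSM.lean`, seat abc-iut-L1-t6, DEFS-FROZEN). The cell's landed closers state their
instance forms at the three NAMED towers `towerA π`, `towerN π`, `towerR π` as CONJUNCTIONS
(`ArchFrd.prop34_vi_irreducible`, `ArchFrd.Tower.propVI_irreducible_holds`;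
`ArchFrd.prop34_viii_of_isComplex`); here each conjunct is recorded under its own name so that the
conclusion HEAD of every theorem IS the row's declaration (L-F head-match grammar, L1-lead
2026-08-26T13:25:03Z (a)), exactly as the sibling rows already have (`ArchFrd.A.propI`, `A.propII`,
`A.propIV`, `A.propV`, `A.propVI`, `A.propVII`, `A.propVI_FSMI`, and their `N.`/`R.` twins).

* F-0824, hypothesis-free over EVERY base `π : D ⥤ D₀`: `A.propVI_irreducible`, `N.…`, `R.…` — the
  general implication (vi) ⇒ "irreducible morphisms of `F` project to isomorphisms or irreducible
  morphisms of `D`" for ANY tower (`ArchFrd.Tower.propVI_irreducible_of_propVI`, abc-iut-L1-d3,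
  `ArchimedeanFSMLifting.lean`) applied to the landed (vi) `A.propVI`/`N.propVI`/`R.propVI`.
* F-0822, in the COMPLEX REGIME (every object of `D` over `Spec ℂ`) for `D` totally epimorphic
  ([FrdII] Ex. 3.3 (i) standing hypothesis) and of FSMFF-type in the author's revised (2024) sense:
  `A.propVIII_of_isComplex`, `N.…`, `R.…` — the conjuncts of `ArchFrd.prop34_viii_of_isComplex`
  (`ArchimedeanFSMFFComplexRegime.lean`). As typed WITHOUT these hypotheses the row is refuted at every
  named tower over the genuine base `π = 𝟭 D₀` (`ArchFrd.towerA_id_not_propVIII`,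
  `towerN_id_not_propVIII`, `towerR_id_not_propVIII`); refuted-as-typed ≠ refuted-in-print.

A FACT row is an assumption label on OUR typed statement, not an endorsement; typed ≠ proved for
anything not cited here; nothing here bears on, and no side is taken on, [IUTchIII] Cor. 3.12.
-/

namespace Literature.AlgebraicGeometry.Frobenioids

open CategoryTheory

noncomputable section

namespace ArchFrd

universe v u

variable {D : Type u} [Category.{v} D] (π : D ⥤ D0)

/-! ### F-0824 `Tower.PropVI_irreducible` at the three named towers, one head each -/

/-- **[FrdII] Prop. 3.4 (vi), "in particular", for `F = A`** over EVERY base `π : D ⥤ D₀`: "irreducible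
morphisms of `F` project to either isomorphisms or irreducible morphisms of `D`" (kurims p. 30
ll. 20–21) — `Tower.propVI_irreducible_of_propVI` applied to the landed `A.propVI`. No hypothesis.
[cite: MochizukiFrdII2008, Prop 3.4 (vi) p.30] -/
theorem A.propVI_irreducible :
    Literature.AlgebraicGeometry.Frobenioids.ArchFrd.Tower.PropVI_irreducible (towerA π) :=
  (towerA π).propVI_irreducible_of_propVI (A.propVI π)

/-- **[FrdII] Prop. 3.4 (vi), "in particular", for `F = N`** over EVERY base `π : D ⥤ D₀`. No hypothesis.
[cite: MochizukiFrdII2008, Prop 3.4 (vi) p.30] -/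
theorem N.propVI_irreducible :
    Literature.AlgebraicGeometry.Frobenioids.ArchFrd.Tower.PropVI_irreducible (towerN π) :=
  (towerN π).propVI_irreducible_of_propVI (N.propVI π)

/-- **[FrdII] Prop. 3.4 (vi), "in particular", for `F = R`** over EVERY base `π : D ⥤ D₀`. No hypothesis.
[cite: MochizukiFrdII2008, Prop 3.4 (vi) p.30] -/
theorem R.propVI_irreducible :
    Literature.AlgebraicGeometry.Frobenioids.ArchFrd.Tower.PropVI_irreducible (towerR π) :=
  (towerR π).propVI_irreducible_of_propVI (R.propVI π)

/-! ### F-0822 `Tower.PropVIII` at the three named towers in the complex regime, one head each -/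

/-- **[FrdII] Prop. 3.4 (viii) for `F = A`, the typed per-tower item, COMPLEX REGIME**: if every object
of `D` lies over `Spec ℂ`, `D` is totally epimorphic and of FSMFF-type (2024), then `(towerA π).PropVIII`
("`F` is complexifiable, RC-connected, totally epimorphic, and of FSMFF-type", kurims p. 30; the typed
antecedents "`D` complexifiable", "`D` of FSMFF-type (2008)" are then unnecessary resp. superseded, and
"`D` RC-connected" is consumed as typed) — first conjunct of `prop34_viii_of_isComplex`.
[cite: MochizukiFrdII2008, Prop 3.4 (viii) p.30] -/
theorem A.propVIII_of_isComplex (hD : ∀ d : D, (π.obj d).IsComplex) (hte : IsTotallyEpimorphic D)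
    (hFF : IsOfFSMFFType2024 D) :
    Literature.AlgebraicGeometry.Frobenioids.ArchFrd.Tower.PropVIII (towerA π) :=
  (prop34_viii_of_isComplex π hD hte hFF).1

/-- **[FrdII] Prop. 3.4 (viii) for `F = N`, the typed per-tower item, COMPLEX REGIME** — second conjunct
of `prop34_viii_of_isComplex`. [cite: MochizukiFrdII2008, Prop 3.4 (viii) p.30] -/
theorem N.propVIII_of_isComplex (hD : ∀ d : D, (π.obj d).IsComplex) (hte : IsTotallyEpimorphic D)
    (hFF : IsOfFSMFFType2024 D) :
    Literature.AlgebraicGeometry.Frobenioids.ArchFrd.Tower.PropVIII (towerN π) :=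
  (prop34_viii_of_isComplex π hD hte hFF).2.1

/-- **[FrdII] Prop. 3.4 (viii) for `F = R`, the typed per-tower item, COMPLEX REGIME** — third conjunct
of `prop34_viii_of_isComplex`. [cite: MochizukiFrdII2008, Prop 3.4 (viii) p.30] -/
theorem R.propVIII_of_isComplex (hD : ∀ d : D, (π.obj d).IsComplex) (hte : IsTotallyEpimorphic D)
    (hFF : IsOfFSMFFType2024 D) :
    Literature.AlgebraicGeometry.Frobenioids.ArchFrd.Tower.PropVIII (towerR π) :=
  (prop34_viii_of_isComplex π hD hte hFF).2.2

end ArchFrd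

end

end Literature.AlgebraicGeometry.Frobenioids
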